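import Literature.Analysis.FluidPDE.OnsagerBDSVAntidivCurl
import Literature.Analysis.FunctionSpaces.TorusClassicalNSUniqueness
import Literature.Analysis.FluidPDE.OnsagerBDSVBiotSavart
import Literature.Analysis.FluidPDE.OnsagerBDSVStability33
import Literature.Analysis.FluidPDE.OnsagerBDSVTransportHigher
import HarnessLib

/-!
# Vector calculus of the Biot–Savart potential on `𝕋³`: `curl curl`, `ℬ curl`, and the Helmholtz
# reconstruction

De Rosa's proof of the vector-potential bounds (Comm. PDE 44 (2019) = arXiv:1801.10235, §5.2,
Prop. 5.4 = BDSV, CPAM 72 (2019), Prop. 3.4) manipulates the potentials `zᵢ = ℬvᵢ = (-Δ)⁻¹ curl vᵢ`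
((5.22): "`div zᵢ = 0` and `curl zᵢ = vᵢ - ∫vᵢ`") through the identities `curl curl = -Δ + ∇div`,
`curl ∇ = 0`, and the reconstruction of a field from its curl, divergence and mean. This file
proves these identities for the accepted objects `BDSV.curl`, `BDSV.biotSavart`,
`Torus.gradient/divergence/laplacian/invLaplacian` (all for smooth fields on `𝕋³`):

* `BDSV.curl_gradient` — `curl ∇θ = 0`;
* `BDSV.curl_curl` — `curl curl v = ∇(div v) - Δv` (general smooth `v`; the divergence-free case
  is the accepted `BDSV.curl_curl_of_isDivFree`);
* `BDSV.biotSavart_eq_neg_curl_invLaplacian` — `ℬv = -curl Δ⁻¹v`; `BDSV.integral_biotSavart`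
  (`∫ℬv = 0`; `div ℬv = 0` is the accepted `BDSV.divergence_biotSavart`);
* `BDSV.invLaplacian_gradient` — `Δ⁻¹∇θ = ∇Δ⁻¹θ`;
* `BDSV.biotSavart_curl` — **`ℬ(curl X) = X - ∫X - ∇Δ⁻¹(div X)`**, equivalently the **Helmholtz
  reconstruction** `BDSV.eq_biotSavart_curl_add` — `X = ∫X + ℬ(curl X) + ∇Δ⁻¹(div X)`: a smooth
  field on `𝕋³` is determined by its curl, its divergence and its mean;
* `BDSV.biotSavart_gradient` — `ℬ(∇θ) = 0`.

## References

* L. De Rosa, Comm. PDE 44 (2019) = arXiv:1801.10235, §5.2 (5.22) and the proof of Prop. 5.4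
  ("the identity `curl curl = -Δ + ∇div`"). [`Derosa2018`]
* T. Buckmaster, C. De Lellis, L. Székelyhidi Jr., V. Vicol, CPAM 72 (2019) = arXiv:1701.08678,
  §3.3 (vector potentials, proof of Prop. 3.4). [`BuckmasterEtAl2018`]
* A. J. Majda, A. L. Bertozzi, *Vorticity and incompressible flow*, CUP (2002), §2.4.1.
-/

noncomputable section

open MeasureTheory Set Filter Function
open scoped ContDiff

namespace Literature.Analysis.FluidPDE

namespace BDSV

open FunctionSpaces FunctionSpaces.Torus

/-! ## `curl ∇ = 0` and `curl curl = ∇div - Δ` -/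

section CurlIdentities

variable {v : UnitAddTorus (Fin 3) → EuclideanSpace ℝ (Fin 3)} {θ : UnitAddTorus (Fin 3) → ℝ}

/-- The coordinates of the gradient: `(∇θ)ₖ = ∂ₖθ` (`C¹` scalar `θ` on `𝕋³`). [folklore] -/
theorem gradient_apply' (hθ : IsContDiff 1 θ) (x : UnitAddTorus (Fin 3)) (k : Fin 3) :
    Torus.gradient θ x k = partialDeriv k θ x := by
  rw [gradient_eq_sum_partialDeriv hθ]
  simp [Fin.sum_univ_three]
  fin_cases k <;> simp

/-- The partial derivatives of the gradient in coordinates: `(∂ⱼ∇θ)ₖ = ∂ⱼ∂ₖθ` (smooth `θ`). [folklore] -/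
theorem partialDeriv_gradient_apply (hθ : IsSmooth θ) (j k : Fin 3) (x : UnitAddTorus (Fin 3)) :
    partialDeriv j (Torus.gradient θ) x k = partialDeriv j (partialDeriv k θ) x := by
  have h1 : IsContDiff 1 (Torus.gradient θ) := hθ.gradient.isContDiff (by simp)
  rw [← partialDeriv_apply_coord h1 j x k]
  congr 1
  funext y
  exact gradient_apply' (hθ.isContDiff (by simp)) y k

/-- **`curl ∇θ = 0`** for smooth `θ` on `𝕋³` (Schwarz). [folklore] -/
theorem curl_gradient (hθ : IsSmooth θ) (x : UnitAddTorus (Fin 3)) : curl (Torus.gradient θ) x = 0 := by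
  ext i
  fin_cases i
  · simp only [Fin.zero_eta, PiLp.zero_apply]
    rw [curl_apply_zero, partialDeriv_gradient_apply hθ, partialDeriv_gradient_apply hθ, partialDeriv_comm hθ 1 2 x, sub_self]
  · simp only [Fin.mk_one, PiLp.zero_apply]
    rw [curl_apply_one, partialDeriv_gradient_apply hθ, partialDeriv_gradient_apply hθ, partialDeriv_comm hθ 2 0 x, sub_self]
  · simp only [Fin.reduceFinMk, PiLp.zero_apply]
    rw [curl_apply_two, partialDeriv_gradient_apply hθ, partialDeriv_gradient_apply hθ, partialDeriv_comm hθ 0 1 x, sub_self]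

/-- The gradient of the divergence in coordinates: `(∇ div v)ᵢ = ∑ₘ (∂ᵢ∂ₘv)ₘ` (smooth `v`). [folklore] -/
theorem gradient_divergence_apply (hv : IsSmooth v) (x : UnitAddTorus (Fin 3)) (i : Fin 3) :
    Torus.gradient (divergence v) x i = ∑ m : Fin 3, partialDeriv i (partialDeriv m v) x m := by
  have hd : IsSmooth (divergence v) := hv.divergence
  rw [gradient_apply' (hd.isContDiff (by simp)) x i]
  have e : divergence v = fun y => ∑ m : Fin 3, partialDeriv m (fun z => v z m) y := rfl
  rw [e, partialDeriv_finset_sum _ (fun m _ => ((hv.apply m).partialDeriv m).isContDiff (by simp))]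
  refine Finset.sum_congr rfl fun m _ => ?_
  have e2 : partialDeriv m (fun z => v z m) = fun z => partialDeriv m v z m :=
    funext fun z => partialDeriv_apply_coord (hv.isContDiff (by simp)) m z m
  rw [e2, partialDeriv_apply_coord ((hv.partialDeriv m).isContDiff (by simp)) i x m, partialDeriv_comm hv i m x]

/-- **`curl (curl v) = ∇(div v) - Δv`** for smooth `v` on `𝕋³` (Majda–Bertozzi §2.4.1; De Rosa, proof
of Prop. 5.4: "the identity `curl curl = -Δ + ∇div`"). [cite: Derosa2018, §5.2 Prop. 5.4 (proof)] -/
theorem curl_curl (hv : IsSmooth v) (x : UnitAddTorus (Fin 3)) :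
    curl (curl v) x = Torus.gradient (divergence v) x - Torus.laplacian v x := by
  -- coordinates of the Laplacian
  have hlap : ∀ i : Fin 3, Torus.laplacian v x i = ∑ m : Fin 3, partialDeriv m (partialDeriv m v) x i := by
    intro i
    rw [laplacian_eq_sum_partialDeriv_partialDeriv hv]
    simp [Finset.sum_apply]
  ext i
  fin_cases i
  · simp only [Fin.zero_eta, PiLp.sub_apply]
    rw [curl_apply_zero, partialDeriv_curl hv, partialDeriv_curl hv, curl_apply_two, curl_apply_one, hlap 0,
      gradient_divergence_apply hv x 0]
    simp only [Fin.sum_univ_three]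
    ring
  · simp only [Fin.mk_one, PiLp.sub_apply]
    rw [curl_apply_one, partialDeriv_curl hv, partialDeriv_curl hv, curl_apply_zero, curl_apply_two, hlap 1,
      gradient_divergence_apply hv x 1]
    simp only [Fin.sum_univ_three]
    ring
  · simp only [Fin.reduceFinMk, PiLp.sub_apply]
    rw [curl_apply_two, partialDeriv_curl hv, partialDeriv_curl hv, curl_apply_one, curl_apply_zero, hlap 2,
      gradient_divergence_apply hv x 2]
    simp only [Fin.sum_univ_three]
    ring

end CurlIdentities

/-! ## The Biot–Savart potential: `ℬ = -curl Δ⁻¹`, `div ℬ = 0`, `∫ℬ = 0` -/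

section BiotSavart

variable {v w X : UnitAddTorus (Fin 3) → EuclideanSpace ℝ (Fin 3)} {θ : UnitAddTorus (Fin 3) → ℝ}

/-- `ℬw = -curl Δ⁻¹w` for smooth `w` (`Δ⁻¹` commutes with `curl`). [cite: BuckmasterEtAl2018, §3.3 (vector potentials)] -/
theorem biotSavart_eq_neg_curl_invLaplacian (hw : IsSmooth w) :
    biotSavart w = fun x => -curl (invLaplacian w) x := by
  rw [biotSavart_eq]
  funext x
  simp only [Pi.neg_apply]
  rw [invLaplacian_curl hw x]

/-- **`∫ℬw = 0`** (`Δ⁻¹` has zero mean). [folklore] -/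
theorem integral_biotSavart (hw : IsSmooth w) : ∫ x, biotSavart w x = 0 := by
  rw [biotSavart_eq]
  simp only [Pi.neg_apply, integral_neg, neg_eq_zero]
  exact integral_invLaplacian (isSmooth_curl hw)

/-- **`Δ⁻¹(∇θ) = ∇(Δ⁻¹θ)`** for smooth `θ` (`Δ⁻¹` commutes with the partial derivatives). [folklore] -/
theorem invLaplacian_gradient (hθ : IsSmooth θ) (x : UnitAddTorus (Fin 3)) :
    invLaplacian (Torus.gradient θ) x = Torus.gradient (invLaplacian θ) x := by
  have hI : IsSmooth (invLaplacian θ) := isSmooth_invLaplacian hθ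
  have e : Torus.gradient θ = ∑ k : Fin 3, fun y => partialDeriv k θ y • EuclideanSpace.single k (1 : ℝ) := by
    funext y
    rw [gradient_eq_sum_partialDeriv (hθ.isContDiff (by simp))]
    simp [Finset.sum_apply]
  have hk : ∀ k : Fin 3, IsSmooth (fun y => partialDeriv k θ y • EuclideanSpace.single k (1 : ℝ)) := fun k =>
    (hθ.partialDeriv k).smul_const _
  rw [e, invLaplacian_finset_sum _ (fun k _ => hk k), gradient_eq_sum_partialDeriv (hI.isContDiff (by simp))]
  simp only [Finset.sum_apply]
  refine Finset.sum_congr rfl fun k _ => ?_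
  have e2 : (fun y => partialDeriv k θ y • EuclideanSpace.single k (1 : ℝ)) =
      (ContinuousLinearMap.smulRight (1 : ℝ →L[ℝ] ℝ) (EuclideanSpace.single k (1 : ℝ))) ∘ partialDeriv k θ := by
    funext y; simp
  rw [e2, invLaplacian_clm_comp (hθ.partialDeriv k), comp_apply, ← partialDeriv_invLaplacian hθ k x]
  simp

/-- **`ℬ(curl X) = X - ∫X - ∇Δ⁻¹(div X)`** for smooth `X` on `𝕋³`:
`ℬ curl X = -Δ⁻¹(curl curl X) = -Δ⁻¹(∇div X - ΔX) = Δ⁻¹ΔX - ∇Δ⁻¹div X` and `Δ⁻¹ΔX = X - ∫X`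
(the mean-free divergence-free case is `BDSV.curl_biotSavart`). [cite: Derosa2018, §5.2 Prop. 5.4 (proof, `curl curl = -Δ + ∇div`)] -/
theorem biotSavart_curl (hX : IsSmooth X) (x : UnitAddTorus (Fin 3)) :
    biotSavart (curl X) x = X x - (∫ y, X y) - Torus.gradient (invLaplacian (divergence X)) x := by
  have hc : IsSmooth (curl X) := isSmooth_curl hX
  have hcc : curl (curl X) = (Torus.gradient (divergence X)) - Torus.laplacian X := by
    funext y; rw [curl_curl hX y]; rfl
  have hg : IsSmooth (Torus.gradient (divergence X)) := hX.divergence.gradient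
  rw [biotSavart_eq, Pi.neg_apply, hcc, invLaplacian_sub hg hX.laplacian, Pi.sub_apply, invLaplacian_laplacian hX x,
    invLaplacian_gradient hX.divergence x]
  abel

/-- **Helmholtz reconstruction on `𝕋³`**: a smooth field is determined by its curl, divergence and
mean, `X = ∫X + ℬ(curl X) + ∇Δ⁻¹(div X)`. [cite: Derosa2018, §5.2 Prop. 5.4 (proof)] -/
theorem eq_biotSavart_curl_add (hX : IsSmooth X) (x : UnitAddTorus (Fin 3)) :
    X x = (∫ y, X y) + biotSavart (curl X) x + Torus.gradient (invLaplacian (divergence X)) x := by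
  rw [biotSavart_curl hX x]
  abel

/-- **`ℬ(∇θ) = 0`** for smooth `θ` (`curl ∇ = 0`: the pressure drops out of the potential equation,
De Rosa p. 13: "Taking the curl of (5.27) the pressure term drops out"). [cite: Derosa2018, §5.2 Prop. 5.4 (proof)] -/
theorem biotSavart_gradient (hθ : IsSmooth θ) : biotSavart (Torus.gradient θ) = 0 := by
  have hc : curl (Torus.gradient θ) = 0 := funext (curl_gradient hθ)
  rw [biotSavart_eq, hc, invLaplacian_zero, neg_zero]

end BiotSavart

/-! ## Transport identities: `curl((u·∇)Z)`, `((curl Z)·∇)f` -/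

section Transport

variable {u Z : UnitAddTorus (Fin 3) → EuclideanSpace ℝ (Fin 3)} {f : UnitAddTorus (Fin 3) → ℝ}

/-- Components of `(u·∇)(curl Z)`: `((u·∇)curl Z)₀ = ((u·∇)∂₁Z)₂ - ((u·∇)∂₂Z)₁`, and cyclically. [folklore] -/
theorem convect_curl_apply (hZ : IsSmooth Z) (u : UnitAddTorus (Fin 3) → EuclideanSpace ℝ (Fin 3)) (x : UnitAddTorus (Fin 3)) :
    convect u (curl Z) x 0 = convect u (partialDeriv 1 Z) x 2 - convect u (partialDeriv 2 Z) x 1 ∧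
    convect u (curl Z) x 1 = convect u (partialDeriv 2 Z) x 0 - convect u (partialDeriv 0 Z) x 2 ∧
    convect u (curl Z) x 2 = convect u (partialDeriv 0 Z) x 1 - convect u (partialDeriv 1 Z) x 0 := by
  have hc : IsSmooth (curl Z) := isSmooth_curl hZ
  have hD : ∀ j, IsSmooth (partialDeriv j Z) := fun j => hZ.partialDeriv j
  have hDc : ∀ j c, IsContDiff 1 (fun y => partialDeriv j Z y c) := fun j c => ((hD j).apply c).isContDiff (by simp)
  have key : ∀ (a j k c d : Fin 3), (∀ y, curl Z y a = partialDeriv j Z y c - partialDeriv k Z y d) →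
      convect u (curl Z) x a = convect u (partialDeriv j Z) x c - convect u (partialDeriv k Z) x d := by
    intro a j k c d hform
    rw [convect_apply_coord hc u x a, show (fun y => curl Z y a) = (fun y => partialDeriv j Z y c) - fun y => partialDeriv k Z y d from
      funext fun y => by rw [Pi.sub_apply]; exact hform y,
      convect_sub_right (hDc j c) (hDc k d), ← convect_apply_coord (hD j) u x c, ← convect_apply_coord (hD k) u x d]
  exact ⟨key 0 1 2 2 1 fun y => curl_apply_zero Z y, key 1 2 0 0 2 fun y => curl_apply_one Z y,
    key 2 0 1 1 0 fun y => curl_apply_two Z y⟩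

/-- **`curl((u·∇)Z) = (u·∇)(curl Z) + (∂u·∇Z)`-terms**: for smooth `u, Z` on `𝕋³`,
`(curl((u·∇)Z))₀ = ((u·∇)curl Z)₀ + ((∂₁u·∇)Z)₂ - ((∂₂u·∇)Z)₁`, and cyclically (Schwarz; De Rosa,
proof of Prop. 5.4: "`v_ℓ·∇(vᵢ - v_ℓ) = curl((v_ℓ·∇)z̃ᵢ) + div((z̃ᵢ×∇)v_ℓ)`"). [cite: Derosa2018, §5.2 Prop. 5.4 (proof)] -/
theorem curl_convect (hu : IsSmooth u) (hZ : IsSmooth Z) (x : UnitAddTorus (Fin 3)) :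
    curl (convect u Z) x = convect u (curl Z) x +
      WithLp.toLp 2 ![convect (partialDeriv 1 u) Z x 2 - convect (partialDeriv 2 u) Z x 1,
        convect (partialDeriv 2 u) Z x 0 - convect (partialDeriv 0 u) Z x 2,
        convect (partialDeriv 0 u) Z x 1 - convect (partialDeriv 1 u) Z x 0] := by
  obtain ⟨h0, h1, h2⟩ := convect_curl_apply hZ u x
  have hD : ∀ j, IsSmooth (partialDeriv j Z) := fun j => hZ.partialDeriv j
  -- `((u·∇)∂ⱼZ)_c = ((u·∇)∂ⱼ'Z)_c`-type symmetry: `(u·∇)(∂ⱼZ) = ∑ₖ uₖ ∂ₖ∂ⱼZ = ∑ₖ uₖ ∂ⱼ∂ₖZ`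
  have hsymm : ∀ (j c : Fin 3), convect u (partialDeriv j Z) x c = (partialDeriv j (convect u Z) x - convect (partialDeriv j u) Z x) c := by
    intro j c
    rw [partialDeriv_convect hu hZ j x, add_sub_cancel_left]
  ext a
  fin_cases a
  · simp only [Fin.zero_eta, PiLp.add_apply]
    rw [curl_apply_zero, h0, hsymm 1 2, hsymm 2 1]
    simp
    ring
  · simp only [Fin.mk_one, PiLp.add_apply]
    rw [curl_apply_one, h1, hsymm 2 0, hsymm 0 2]
    simp
    ring
  · simp only [Fin.reduceFinMk, PiLp.add_apply]
    rw [curl_apply_two, h2, hsymm 0 1, hsymm 1 0]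
    simp
    ring

/-- The derivative of the divergence constraint: `∑ⱼ (∂ⱼ∂_b u)ⱼ = ∂_b(div u) = 0` for smooth
divergence-free `u`. [folklore] -/
theorem sum_partialDeriv_partialDeriv_apply_eq_zero (hu : IsSmooth u) (hdiv : IsDivFree u) (b : Fin 3)
    (x : UnitAddTorus (Fin 3)) : ∑ j : Fin 3, partialDeriv j (partialDeriv b u) x j = 0 := by
  have hu1 : IsContDiff 1 u := hu.isContDiff (by simp)
  have hd : divergence u = fun _ => (0 : ℝ) := funext hdiv
  have h1 : partialDeriv b (divergence u) x = 0 := by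
    rw [hd]
    simp [partialDeriv, FunctionSpaces.Torus.lineDeriv]
  have h2 : partialDeriv b (divergence u) x = ∑ m : Fin 3, partialDeriv b (partialDeriv m u) x m := by
    have e : divergence u = fun y => ∑ m : Fin 3, partialDeriv m (fun z => u z m) y := rfl
    rw [e, partialDeriv_finset_sum _ (fun m _ => ((hu.apply m).partialDeriv m).isContDiff (by simp))]
    refine Finset.sum_congr rfl fun m _ => ?_
    have e2 : partialDeriv m (fun z => u z m) = fun z => partialDeriv m u z m :=
      funext fun z => partialDeriv_apply_coord hu1 m z m
    rw [e2, partialDeriv_apply_coord ((hu.partialDeriv m).isContDiff (by simp)) b x m]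
  rw [← h1, h2]
  exact Finset.sum_congr rfl fun j _ => by rw [partialDeriv_comm hu j b x]

/-- **`((∂_b u·∇)Z)_c = div(Z_c ∂_b u)`** for smooth `u, Z` with `div u = 0` (moving the derivative off
`Z`: `∑ⱼ ∂_b uⱼ ∂ⱼZ_c = ∑ⱼ ∂ⱼ(Z_c ∂_b uⱼ)`), the structure behind De Rosa's
"`div((z̃ᵢ×∇)v_ℓ)`". [cite: Derosa2018, §5.2 Prop. 5.4 (proof)] -/
theorem convect_partialDeriv_apply_eq_divergence (hu : IsSmooth u) (hdiv : IsDivFree u) (hZ : IsSmooth Z)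
    (b c : Fin 3) (x : UnitAddTorus (Fin 3)) :
    convect (partialDeriv b u) Z x c = divergence (fun y => Z y c • partialDeriv b u y) x := by
  have hZ1 : IsContDiff 1 Z := hZ.isContDiff (by simp)
  have hZc : IsSmooth (fun y => Z y c) := hZ.apply c
  have hDb : IsSmooth (partialDeriv b u) := hu.partialDeriv b
  rw [convect_apply_coord_sum hZ1]
  rw [divergence]
  have e : ∀ j, (fun y => (Z y c • partialDeriv b u y) j) = fun y => Z y c * partialDeriv b u y j := by
    intro j; funext y; simp
  simp_rw [e]
  have hprod : ∀ j, partialDeriv j (fun y => Z y c * partialDeriv b u y j) x =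
      Z x c * partialDeriv j (partialDeriv b u) x j + partialDeriv j Z x c * partialDeriv b u x j := by
    intro j
    rw [partialDeriv_mul (hZc.isContDiff (by simp)) ((hDb.apply j).isContDiff (by simp)),
      partialDeriv_apply_coord (hDb.isContDiff (by simp)) j x j, partialDeriv_apply_coord hZ1 j x c]
  simp_rw [hprod]
  rw [Finset.sum_add_distrib, ← Finset.mul_sum, sum_partialDeriv_partialDeriv_apply_eq_zero hu hdiv b x, mul_zero, zero_add]
  exact Finset.sum_congr rfl fun j _ => mul_comm _ _

/-- **`((curl Z)·∇)f = div(Z × ∇f)`** for smooth `Z` and scalar `f` on `𝕋³`: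
`∑ⱼ (curl Z)ⱼ ∂ⱼf = ∂₀(Z₁∂₂f - Z₂∂₁f) + ∂₁(Z₂∂₀f - Z₀∂₂f) + ∂₂(Z₀∂₁f - Z₁∂₀f)` (the second derivatives of
`f` cancel; De Rosa: "`((vᵢ - v_ℓ)·∇)vᵢ = div((z̃ᵢ×∇)vᵢᵀ)`"). [cite: Derosa2018, §5.2 Prop. 5.4 (proof)] -/
theorem sum_curl_mul_partialDeriv_eq_divergence (hZ : IsSmooth Z) (hf : IsSmooth f) (x : UnitAddTorus (Fin 3)) :
    ∑ j : Fin 3, curl Z x j * partialDeriv j f x =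
      divergence (fun y => WithLp.toLp 2 ![Z y 1 * partialDeriv 2 f y - Z y 2 * partialDeriv 1 f y,
        Z y 2 * partialDeriv 0 f y - Z y 0 * partialDeriv 2 f y,
        Z y 0 * partialDeriv 1 f y - Z y 1 * partialDeriv 0 f y]) x := by
  have hZ1 : IsContDiff 1 Z := hZ.isContDiff (by simp)
  have hZc : ∀ c, IsContDiff 1 (fun y => Z y c) := fun c => (hZ.apply c).isContDiff (by simp)
  have hdf : ∀ j, IsContDiff 1 (partialDeriv j f) := fun j => (hf.partialDeriv j).isContDiff (by simp)
  have hprod : ∀ c j, IsContDiff 1 (fun y => Z y c * partialDeriv j f y) := fun c j => (hZc c).mul (hdf j)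
  -- the three coordinate functions
  have e0 : (fun y => (WithLp.toLp 2 ![Z y 1 * partialDeriv 2 f y - Z y 2 * partialDeriv 1 f y,
      Z y 2 * partialDeriv 0 f y - Z y 0 * partialDeriv 2 f y,
      Z y 0 * partialDeriv 1 f y - Z y 1 * partialDeriv 0 f y] : EuclideanSpace ℝ (Fin 3)) 0) =
      fun y => Z y 1 * partialDeriv 2 f y - Z y 2 * partialDeriv 1 f y := by funext y; simp
  have e1 : (fun y => (WithLp.toLp 2 ![Z y 1 * partialDeriv 2 f y - Z y 2 * partialDeriv 1 f y,
      Z y 2 * partialDeriv 0 f y - Z y 0 * partialDeriv 2 f y,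
      Z y 0 * partialDeriv 1 f y - Z y 1 * partialDeriv 0 f y] : EuclideanSpace ℝ (Fin 3)) 1) =
      fun y => Z y 2 * partialDeriv 0 f y - Z y 0 * partialDeriv 2 f y := by funext y; simp
  have e2 : (fun y => (WithLp.toLp 2 ![Z y 1 * partialDeriv 2 f y - Z y 2 * partialDeriv 1 f y,
      Z y 2 * partialDeriv 0 f y - Z y 0 * partialDeriv 2 f y,
      Z y 0 * partialDeriv 1 f y - Z y 1 * partialDeriv 0 f y] : EuclideanSpace ℝ (Fin 3)) 2) =
      fun y => Z y 0 * partialDeriv 1 f y - Z y 1 * partialDeriv 0 f y := by funext y; simp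
  have psub : ∀ {F G : UnitAddTorus (Fin 3) → ℝ} (hF : IsContDiff 1 F) (hG : IsContDiff 1 G) (i : Fin 3),
      partialDeriv i (fun y => F y - G y) x = partialDeriv i F x - partialDeriv i G x :=
    fun hF hG i => congrFun (partialDeriv_sub hF hG i) x
  rw [divergence, Fin.sum_univ_three, Fin.sum_univ_three, e0, e1, e2,
    psub (hprod 1 2) (hprod 2 1), psub (hprod 2 0) (hprod 0 2), psub (hprod 0 1) (hprod 1 0)]
  simp only [partialDeriv_mul (hZc _) (hdf _), partialDeriv_apply_coord hZ1]
  rw [curl_apply_zero, curl_apply_one, curl_apply_two, partialDeriv_comm hf 0 1 x, partialDeriv_comm hf 0 2 x,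
    partialDeriv_comm hf 1 2 x]
  ring

end Transport

end BDSV

end Literature.Analysis.FluidPDE
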